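import Summits.Ventures.HSemireg.WedgeHankelSiegelIdealPieces
import Summits.Ventures.HSemireg.WedgeHankelOuterFamilyPure

/-!
# Venture HSemireg — EVERY CLASS MAP FACTORS THROUGH THE SYMMETRISATION, AND THE EXCESS LAW IN MAP FORM: `θ ↦ θ ∧ w_N(q)` on `⋀^k` is `φ_q ∘ sym` for a linear `φ_q`; on the
# pure piece of a `k`-set `A` of pairs, `sym` has kernel `SI_k ⊓ Sp(𝟙_A)` and a `(k+1)`-dimensional image, through which the class map has rank `rank H_k(q)`; and for a finite
# FAMILY of classes the pure piece of the joint kernel exceeds `SI_k ⊓ Sp(𝟙_A)` by exactly `k + 1 − rank [H_k(q_c)]_c`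

HONEST FRAMING. Part of the Lean index of the computation cell `pub-hsemireg` (seat p10 gen 24, Sunday typer «UNIFORM-IN-n»).
Finite-dimensional EXTERIOR ALGEBRA over a field + linear algebra of quotients ONLY: no variety, no cohomology theory, no sheaf, no Ext group, no semiregularity map;
nothing here says that HC / HC_CM / HC_AV holds; no Literature fact is declared or used.  Custodian versions as in `WedgeHankelSiegelIdeal` (1/3); the dictionary (`sym` = th-6's «what
polynomial-in-Θ classes can see of `HT^k`»; `SI_k` = the Θ-isotropic part) is QUOTED, never asserted.  The MATRIX of the induced map in the standard monomials (expected: the Hankel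
matrix `H_k(q)` up to unit signs) is NOT computed here — only its rank.

WHAT IS IN THE TREE.  Gen 11 (`WedgeHankelSiegelIdeal*`): `sym`, `symk`, `ker_symk_eq_siegelIdeal` (`ker(sym ∣ ⋀^k) = SI_k`), `mul_w_eq_zero_of_mem_siegelIdeal`, `exteriorPower_eq_Hom_univ`;
L2 `Sp_pure_le`, `finrank_Sp_pure`; L4 `Hom_inf_Sp_pure`, `V_inf_Sp_ptype_succ_eq_map`, `finrank_V_w_inf_Sp_pure_succ`; L8 (`WedgeHankelSiegelIdealPieces`): `siegelIdeal_le_Hom_univ`,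
`finrank_siegelIdeal_inf_Sp_pure_add` (`dim (SI_{|A|} ⊓ Sp(𝟙_A)) + (|A|+1) = 2^{|A|}`), `finrank_Kr_w_inf_Sp_pure_eq_siegelIdeal_add` (one class); J2 (`WedgeHankelOuterFamilyPure`):
`finrank_iInf_Kr_w_inf_Sp_pure_add`; Mathlib: `LinearMap.quotKerEquivRange`, `Submodule.liftQ`, `LinearMap.exists_extend`.
THIS FILE (namespace `Summit.Ventures.HSemireg.Wedge.HankelOuter` continued; imports L8 and J2):
* §410 **`exists_factor_through_of_ker_le`** (fields: `ker g ≤ ker f ⇒ f = φ ∘ g` for some linear `φ` on the whole codomain), **`exists_mul_w_eq_comp_sym`: for every `q` there is a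
  linear `φ_q : SymA → ⋀` with `θ ∧ w_N(q) = φ_q (sym θ)` for all `θ ∈ ⋀^k`** (every field, `N`, `k`, `q`) — the class maps factor through the symmetrisation.
* §411 THE PURE PIECE UNDER `sym`: **`Sp_pure_inf_ker_sym_eq`** (`Sp(𝟙_A) ⊓ ker sym = SI_{|A|} ⊓ Sp(𝟙_A)`), **`finrank_map_sym_Sp_pure`** (`dim sym(Sp(𝟙_A)) = |A| + 1`),
  `finrank_map_mulRight_w_Sp_pure` (`dim (Sp(𝟙_A) ∧ w_N(q)) = rank H_{|A|}(q)`, L4 in map form), `finrank_map_sym_Sp_pure_eq_finrank_map_mulRight_add` (the induced map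
  `sym(Sp(𝟙_A)) → Sp(𝟙_A) ∧ w_N(q)` loses exactly `|A| + 1 − rank H_{|A|}(q)` dimensions: the excess, in map form).
* §412 THE PURE-PIECE EXCESS LAW FOR A FAMILY: `siegelIdeal_inf_Sp_pure_le_Hom_iInf_Kr_w`, **`finrank_Hom_iInf_Kr_w_inf_Sp_pure_eq_siegelIdeal_add`**
  (`dim (Hom ⊓ ⋂_c Kr(w_N q_c) ⊓ Sp(𝟙_A)) + rank [H_{|A|}(q_c)]_c = dim (SI_{|A|} ⊓ Sp(𝟙_A)) + (|A| + 1)`), **`Hom_iInf_Kr_w_inf_Sp_pure_eq_siegelIdeal_inf_iff`** (`… = SI ⊓ Sp(𝟙_A) ↔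
  rank [H_{|A|}(q_c)]_c = |A| + 1`).
READING: L8's excess `k + 1 − r_k(q)` per `k`-set `A` is the corank of ONE linear map `K^{k+1} ≅ Sp(𝟙_A)/(SI ⊓ Sp(𝟙_A)) → (image)`, the quotient realised by `sym`; for a family
the same with the block Hankel rank.  Nothing Ext-side.  New names only.
-/

open Module

namespace Summit.Ventures.HSemireg.Wedge.HankelOuter

open Summit.Ventures.HSemireg.Wedge Summit.Ventures.HSemireg.Wedge.Kunneth Summit.Ventures.HSemireg.Wedge.Hankel
  Summit.Ventures.HSemireg.Wedge.BasisFree Summit.Ventures.HSemireg.Wedge.HankelSiegel Summit.Ventures.HSemireg.Wedge.HankelSiegelIdeal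
  Summit.Ventures.HSemireg.Wedge.KunnethKernel Summit.Ventures.HSemireg.Wedge.HankelFrameChange Summit.Ventures.HSemireg.Wedge.Weil
  Summit.Ventures.HSemireg.Wedge.HankelPairMixing Summit.Ventures.HSemireg.Wedge.HankelPairGrading

variable (K : Type*) [Field K] {N : ℕ} {ι : Type} [Fintype ι] [DecidableEq ι]

/-! ## §410. Every class map factors through the symmetrisation -/

omit [Fintype ι] [DecidableEq ι] in
/-- linear algebra over a field: **if `ker g ≤ ker f` then `f = φ ∘ g` for some linear `φ` defined on the whole codomain of `g`** (factor through `V ⧸ ker g ≅ range g`, then extend). -/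
theorem exists_factor_through_of_ker_le {V W U : Type*} [AddCommGroup V] [Module K V] [AddCommGroup W] [Module K W] [AddCommGroup U] [Module K U]
    (f : V →ₗ[K] W) (g : V →ₗ[K] U) (h : LinearMap.ker g ≤ LinearMap.ker f) : ∃ φ : U →ₗ[K] W, ∀ v, f v = φ (g v) := by
  let h0 : LinearMap.range g →ₗ[K] W := ((LinearMap.ker g).liftQ f h) ∘ₗ g.quotKerEquivRange.symm.toLinearMap
  obtain ⟨φ, hφ⟩ := LinearMap.exists_extend h0
  refine ⟨φ, fun v => ?_⟩
  have h1 : φ (g v) = h0 ⟨g v, LinearMap.mem_range_self g v⟩ := by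
    rw [← hφ]
    rfl
  rw [h1]
  simp only [h0, LinearMap.coe_comp, Function.comp_apply, LinearEquiv.coe_toLinearMap, LinearMap.quotKerEquivRange_symm_apply_image, Submodule.mkQ_apply,
    Submodule.liftQ_apply]

omit [Fintype ι] [DecidableEq ι] in
/-- **EVERY CLASS MAP FACTORS THROUGH THE SYMMETRISATION: for every `q` there is a linear `φ_q : SymA → ⋀` with `θ ∧ w_N(q) = φ_q (sym θ)` for all `θ ∈ ⋀^k`** (every field, `N`, `k`,
`q`): `ker(sym ∣ ⋀^k) = SI_k` (gen 11) lies in the kernel of every class map. -/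
theorem exists_mul_w_eq_comp_sym (k : ℕ) (q : ℕ → K) :
    ∃ φ : SymA K N →ₗ[K] HT K (In N), ∀ θ ∈ ⋀[K]^k (In N → K), θ * w K N N q = φ (sym K θ) := by
  have hker : LinearMap.ker (symk K N k) ≤ LinearMap.ker ((LinearMap.mulRight K (w K N N q)) ∘ₗ (⋀[K]^k (In N → K)).subtype) := by
    rw [ker_symk_eq_siegelIdeal]
    intro θ hθ
    rw [Submodule.mem_comap, Submodule.subtype_apply] at hθ
    rw [LinearMap.mem_ker, LinearMap.comp_apply, Submodule.subtype_apply, LinearMap.mulRight_apply]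
    exact mul_w_eq_zero_of_mem_siegelIdeal K hθ q
  obtain ⟨φ, hφ⟩ := exists_factor_through_of_ker_le K _ _ hker
  refine ⟨φ, fun θ hθ => ?_⟩
  have h := hφ ⟨θ, hθ⟩
  rw [LinearMap.comp_apply, Submodule.subtype_apply, LinearMap.mulRight_apply] at h
  rw [h]
  rfl

/-! ## §411. The pure piece under the symmetrisation: kernel `SI ⊓ Sp(𝟙_A)`, image of dimension `|A| + 1` -/

omit [Fintype ι] [DecidableEq ι] in
/-- **`Sp(ptype = 𝟙_A) ⊓ ker sym = SI_{|A|} ⊓ Sp(ptype = 𝟙_A)`** (the pure piece lives in `⋀^{|A|}`, where `ker sym = SI`). -/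
theorem Sp_pure_inf_ker_sym_eq (A : Finset (Fin N)) :
    Sp K (fun s : Finset (In N) => ptype s = fun c => if c ∈ A then 1 else 0) ⊓ LinearMap.ker (sym K (n := N)).toLinearMap
      = siegelIdeal K N A.card ⊓ Sp K (fun s : Finset (In N) => ptype s = fun c => if c ∈ A then 1 else 0) := by
  have hSp : Sp K (fun s : Finset (In N) => ptype s = fun c => if c ∈ A then 1 else 0) ≤ ⋀[K]^A.card (In N → K) := by
    rw [exteriorPower_eq_Hom_univ]
    exact le_trans (Sp_pure_le K A) inf_le_left
  have hk := ker_symk_eq_siegelIdeal K (n := N) A.card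
  ext θ
  rw [Submodule.mem_inf, Submodule.mem_inf, LinearMap.mem_ker, AlgHom.toLinearMap_apply]
  constructor
  · rintro ⟨hθ, h0⟩
    have h1 : (⟨θ, hSp hθ⟩ : ⋀[K]^A.card (In N → K)) ∈ LinearMap.ker (symk K N A.card) := by
      rw [LinearMap.mem_ker]
      exact h0
    rw [hk, Submodule.mem_comap, Submodule.subtype_apply] at h1
    exact ⟨h1, hθ⟩
  · rintro ⟨hθS, hθ⟩
    have h1 : (⟨θ, hSp hθ⟩ : ⋀[K]^A.card (In N → K)) ∈ LinearMap.ker (symk K N A.card) := by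
      rw [hk, Submodule.mem_comap, Submodule.subtype_apply]
      exact hθS
    rw [LinearMap.mem_ker] at h1
    exact ⟨hθ, h1⟩

omit [Fintype ι] [DecidableEq ι] in
/-- **`dim sym(Sp(ptype = 𝟙_A)) = |A| + 1`**: rank–nullity on the pure piece (`dim 2^{|A|}`, kernel `SI ⊓ Sp(𝟙_A)` of dimension `2^{|A|} − (|A|+1)`, L8) — `sym` realises the quotient
`Sp(𝟙_A) / (SI ⊓ Sp(𝟙_A)) ≅ K^{|A|+1}`. -/
theorem finrank_map_sym_Sp_pure (A : Finset (Fin N)) :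
    finrank K ↥((Sp K (fun s : Finset (In N) => ptype s = fun c => if c ∈ A then 1 else 0)).map (sym K (n := N)).toLinearMap) = A.card + 1 := by
  let g : Sp K (fun s : Finset (In N) => ptype s = fun c => if c ∈ A then 1 else 0) →ₗ[K] SymA K N :=
    (sym K (n := N)).toLinearMap ∘ₗ (Sp K (fun s : Finset (In N) => ptype s = fun c => if c ∈ A then 1 else 0)).subtype
  have hrange : LinearMap.range g = (Sp K (fun s : Finset (In N) => ptype s = fun c => if c ∈ A then 1 else 0)).map (sym K (n := N)).toLinearMap := by
    rw [LinearMap.range_comp, Submodule.range_subtype]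
  have hker : LinearMap.ker g = (siegelIdeal K N A.card ⊓ Sp K (fun s : Finset (In N) => ptype s = fun c => if c ∈ A then 1 else 0)).comap
      (Sp K (fun s : Finset (In N) => ptype s = fun c => if c ∈ A then 1 else 0)).subtype := by
    ext θ
    rw [LinearMap.mem_ker, Submodule.mem_comap, Submodule.subtype_apply, ← Sp_pure_inf_ker_sym_eq, Submodule.mem_inf, LinearMap.mem_ker]
    exact ⟨fun h => ⟨θ.2, h⟩, fun h => h.2⟩
  have hle : siegelIdeal K N A.card ⊓ Sp K (fun s : Finset (In N) => ptype s = fun c => if c ∈ A then 1 else 0)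
      ≤ Sp K (fun s : Finset (In N) => ptype s = fun c => if c ∈ A then 1 else 0) := inf_le_right
  have h := LinearMap.finrank_range_add_finrank_ker g
  rw [hrange, hker, (Submodule.comapSubtypeEquivOfLe hle).finrank_eq, finrank_Sp_pure] at h
  have h2 := finrank_siegelIdeal_inf_Sp_pure_add K A
  omega

omit [Fintype ι] [DecidableEq ι] in
/-- L4 in map form: **`dim (Sp(ptype = 𝟙_A) ∧ w_N(q)) = rank H_{|A|}(q)`** (the image of the pure piece under the class map is the `𝟙_A + 𝟙`-piece of the image). -/
theorem finrank_map_mulRight_w_Sp_pure (A : Finset (Fin N)) (q : ℕ → K) :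
    finrank K ↥((Sp K (fun s : Finset (In N) => ptype s = fun c => if c ∈ A then 1 else 0)).map (LinearMap.mulRight K (w K N N q))) = (hankel1 K N A.card q).rank := by
  rw [← finrank_V_w_inf_Sp_pure_succ K A q, V_inf_Sp_ptype_succ_eq_map K _ (w_mem_Sp_Tr K q), Hom_inf_Sp_pure]

omit [Fintype ι] [DecidableEq ι] in
/-- **THE EXCESS IN MAP FORM: `dim sym(Sp(𝟙_A)) = dim (Sp(𝟙_A) ∧ w_N(q)) + (|A| + 1 − rank H_{|A|}(q))`** — the class map on the pure piece, which factors through the `(|A|+1)`-dimensional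
`sym(Sp(𝟙_A))` (§410), loses exactly L8's excess there. -/
theorem finrank_map_sym_Sp_pure_eq_finrank_map_mulRight_add (A : Finset (Fin N)) (q : ℕ → K) :
    finrank K ↥((Sp K (fun s : Finset (In N) => ptype s = fun c => if c ∈ A then 1 else 0)).map (sym K (n := N)).toLinearMap)
      = finrank K ↥((Sp K (fun s : Finset (In N) => ptype s = fun c => if c ∈ A then 1 else 0)).map (LinearMap.mulRight K (w K N N q)))
        + (A.card + 1 - (hankel1 K N A.card q).rank) := by
  rw [finrank_map_sym_Sp_pure, finrank_map_mulRight_w_Sp_pure]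
  have h := le_trans (Matrix.rank_le_card_height (hankel1 K N A.card q)) (le_of_eq (Fintype.card_fin _))
  omega

/-! ## §412. The pure-piece excess law for a family of classes -/

omit [Fintype ι] [DecidableEq ι] in
/-- `SI_{|A|} ⊓ Sp(𝟙_A) ≤ Hom(univ,|A|) ⊓ ⋂_c Kr(univ, w_N q_c, |A|) ⊓ Sp(𝟙_A)`. -/
theorem siegelIdeal_inf_Sp_pure_le_Hom_iInf_Kr_w (A : Finset (Fin N)) (q : ι → ℕ → K) :
    siegelIdeal K N A.card ⊓ Sp K (fun s : Finset (In N) => ptype s = fun c => if c ∈ A then 1 else 0)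
      ≤ Hom K (In N) (Finset.univ : Finset (In N)) A.card ⊓ (⨅ c, Kr K (Finset.univ : Finset (In N)) (w K N N (q c)) A.card)
          ⊓ Sp K (fun s : Finset (In N) => ptype s = fun c => if c ∈ A then 1 else 0) :=
  inf_le_inf (le_inf (siegelIdeal_le_Hom_univ K _)
    (le_iInf fun c _ hθ => mem_Kr.mpr ⟨siegelIdeal_le_Hom_univ K _ hθ, mul_w_eq_zero_of_mem_siegelIdeal K hθ (q c)⟩)) le_rfl

/-- **THE PURE-PIECE EXCESS LAW FOR A FAMILY: `dim (Hom(univ,|A|) ⊓ ⋂_c Kr(univ, w_N q_c, |A|) ⊓ Sp(𝟙_A)) + rank [H_{|A|}(q_c)]_c = dim (SI_{|A|} ⊓ Sp(𝟙_A)) + (|A| + 1)`** — every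
finite family, every set `A` of pairs, every field. -/
theorem finrank_Hom_iInf_Kr_w_inf_Sp_pure_eq_siegelIdeal_add (A : Finset (Fin N)) (q : ι → ℕ → K) :
    finrank K ↥(Hom K (In N) (Finset.univ : Finset (In N)) A.card ⊓ (⨅ c, Kr K (Finset.univ : Finset (In N)) (w K N N (q c)) A.card)
        ⊓ Sp K (fun s : Finset (In N) => ptype s = fun c => if c ∈ A then 1 else 0))
      + (hank K N A.card (fun (_ : Unit) (c : ι) => q c)).rank
      = finrank K ↥(siegelIdeal K N A.card ⊓ Sp K (fun s : Finset (In N) => ptype s = fun c => if c ∈ A then 1 else 0)) + (A.card + 1) := by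
  rw [finrank_iInf_Kr_w_inf_Sp_pure_add, finrank_siegelIdeal_inf_Sp_pure_add]

/-- **`Hom(univ,|A|) ⊓ ⋂_c Kr(univ, w_N q_c, |A|) ⊓ Sp(𝟙_A) = SI_{|A|} ⊓ Sp(𝟙_A) ↔ rank [H_{|A|}(q_c)]_c = |A| + 1`** — the pure piece of the joint kernel is Siegel iff the block Hankel
matrix of the family has full row rank. -/
theorem Hom_iInf_Kr_w_inf_Sp_pure_eq_siegelIdeal_inf_iff (A : Finset (Fin N)) (q : ι → ℕ → K) :
    Hom K (In N) (Finset.univ : Finset (In N)) A.card ⊓ (⨅ c, Kr K (Finset.univ : Finset (In N)) (w K N N (q c)) A.card)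
          ⊓ Sp K (fun s : Finset (In N) => ptype s = fun c => if c ∈ A then 1 else 0)
        = siegelIdeal K N A.card ⊓ Sp K (fun s : Finset (In N) => ptype s = fun c => if c ∈ A then 1 else 0)
      ↔ (hank K N A.card (fun (_ : Unit) (c : ι) => q c)).rank = A.card + 1 := by
  have h := finrank_Hom_iInf_Kr_w_inf_Sp_pure_eq_siegelIdeal_add K A q
  have hle := siegelIdeal_inf_Sp_pure_le_Hom_iInf_Kr_w K A q
  have hrk : (hank K N A.card (fun (_ : Unit) (c : ι) => q c)).rank ≤ A.card + 1 :=
    le_trans (Matrix.rank_le_card_height _) (by rw [Fintype.card_prod, Fintype.card_unique, Fintype.card_fin, one_mul])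
  constructor
  · intro he
    rw [he] at h
    omega
  · intro hr
    refine (Submodule.eq_of_le_of_finrank_eq hle ?_).symm
    omega

end Summit.Ventures.HSemireg.Wedge.HankelOuter
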